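import Literature.Topology.FourManifolds.TubeIsotopyPushforward
import Literature.Topology.FourManifolds.DiffeotopyProofs
import Literature.Topology.FourManifolds.KirbyMovesSlideSweepPlanar
import HarnessLib

/-!
# Normalising the band end, step B tool: fibre rotations of the tube by a variable angle

Topic `Literature/Topology/FourManifolds`; fact seat `provefact-IsStrictHandleSlide.isSurgery`
(R. C. Kirby, *The Topology of 4-Manifolds*, LNM 1374 (1989), Ch. I §4; remaining content in the
tree: the named fact (S) `Literature.Topology.FourManifolds.FramedLink.IsStrictHandleSlide.slideModel`,
`KirbyMovesHandleSlide.lean`). Second tool for flattening the end of the slide band at the push-off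
`Kⱼ'`: once the band is tangent to the radial planes of the tube `ν` along `Kⱼ'`, it is the graph
`v = c₀ + V(x, r)` of a small defect in the meridional angle `v` over the (base, radius) strip,
and it is flattened by **rotating each fibre circle `{x} × {‖w‖ = r}` by the angle `-V(x, r)`**
— a diffeomorphism of `S¹ × ℝ²` with an explicit inverse (rotate back), the identity near the
core and off a tube, isotopic to the identity through the rotations by `-t V`. Proved here (no
definitions, no named facts):

* `Literature.Topology.FourManifolds.SlideSweep.exists_tubeIsotopy_fibreRotation` — for a smooth
  `a : ℝ² × ℝ → ℝ` with `a (u, s) = 0` for `s ≥ ρ²`, a compactly supported isotopy `Θ` of `S¹ × ℝ²`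
  (`TubeIsotopy`, radius `ρ`) with
  `Θ t (x, w) = (x, cos (t a(x, ‖w‖²)) w + sin (t a(x, ‖w‖²)) J w)`, `J (w₀, w₁) = (-w₁, w₀)`
  (Hirsch, *Differential Topology* (1976), Ch. 8 §1: isotopies with compact support in a tube;
  packaged with `Diffeotopy.mk'` as the tree's `Diffeotopy.tubeTwistIsotopy`,
  `KnotReparametrisation.lean`).

## References

* R. C. Kirby, *The Topology of 4-Manifolds*, LNM 1374, Springer (1989), Ch. I §4. [Kirby1989]
* M. W. Hirsch, *Differential Topology*, GTM 33, Springer (1976), Ch. 8 §1. [HirschDT1976]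
-/

open scoped Manifold ContDiff Topology
open Function Set Metric

noncomputable section

namespace Literature.Topology.FourManifolds

namespace SlideSweep

/-- The rotation `cos θ • w + sin θ • J w` of the plane, as a smooth function of `(θ, w)`.
[folklore] -/
theorem contDiff_rotate :
    ContDiff ℝ ∞ fun p : ℝ × EuclideanSpace ℝ (Fin 2) ↦
      Real.cos p.1 • p.2 + Real.sin p.1 •
        ((-(p.2 1)) • EuclideanSpace.single (0 : Fin 2) (1 : ℝ) + (p.2 0) • EuclideanSpace.single 1 1) := by
  have h0 : ContDiff ℝ ∞ fun p : ℝ × EuclideanSpace ℝ (Fin 2) ↦ p.2 0 :=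
    (contDiff_euclidean.1 contDiff_id 0).comp contDiff_snd
  have h1 : ContDiff ℝ ∞ fun p : ℝ × EuclideanSpace ℝ (Fin 2) ↦ p.2 1 :=
    (contDiff_euclidean.1 contDiff_id 1).comp contDiff_snd
  exact ((Real.contDiff_cos.comp contDiff_fst).smul contDiff_snd).add
    ((Real.contDiff_sin.comp contDiff_fst).smul ((h1.neg.smul contDiff_const).add (h0.smul contDiff_const)))

/-- The rotation in coordinates. [folklore] -/
theorem rotate_eq (θ : ℝ) (w : EuclideanSpace ℝ (Fin 2)) :
    Real.cos θ • w + Real.sin θ •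
        ((-(w 1)) • EuclideanSpace.single (0 : Fin 2) (1 : ℝ) + (w 0) • EuclideanSpace.single 1 1) =
      (Real.cos θ * w 0 - Real.sin θ * w 1) • EuclideanSpace.single (0 : Fin 2) (1 : ℝ) +
        (Real.cos θ * w 1 + Real.sin θ * w 0) • EuclideanSpace.single 1 1 := by
  ext i; fin_cases i <;> simp; ring

/-- Rotations preserve the norm. [folklore] -/
theorem norm_rotate (θ : ℝ) (w : EuclideanSpace ℝ (Fin 2)) :
    ‖Real.cos θ • w + Real.sin θ •
        ((-(w 1)) • EuclideanSpace.single (0 : Fin 2) (1 : ℝ) + (w 0) • EuclideanSpace.single 1 1)‖ = ‖w‖ := by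
  have hw : w = (w 0) • EuclideanSpace.single 0 1 + (w 1) • EuclideanSpace.single 1 1 := by
    ext i; fin_cases i <;> simp
  rw [rotate_eq, norm_smul_single_add_smul_single]
  conv_rhs => rw [hw, norm_smul_single_add_smul_single]
  congr 1
  linear_combination ((w 0) ^ 2 + (w 1) ^ 2) * Real.cos_sq_add_sin_sq θ

/-- Rotating by `-θ` undoes the rotation by `θ` (in coordinates). [folklore] -/
theorem rotate_neg_rotate (θ : ℝ) (w : EuclideanSpace ℝ (Fin 2)) :
    Real.cos (-θ) • ((Real.cos θ * w 0 - Real.sin θ * w 1) • EuclideanSpace.single (0 : Fin 2) (1 : ℝ) +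
        (Real.cos θ * w 1 + Real.sin θ * w 0) • EuclideanSpace.single 1 1) +
      Real.sin (-θ) • ((-(Real.cos θ * w 1 + Real.sin θ * w 0)) • EuclideanSpace.single (0 : Fin 2) (1 : ℝ) +
        (Real.cos θ * w 0 - Real.sin θ * w 1) • EuclideanSpace.single 1 1) = w := by
  have hw : w = (w 0) • EuclideanSpace.single 0 1 + (w 1) • EuclideanSpace.single 1 1 := by
    ext i; fin_cases i <;> simp
  have h0 : Real.cos θ * (Real.cos θ * w 0 - Real.sin θ * w 1) -
      -Real.sin θ * (Real.cos θ * w 1 + Real.sin θ * w 0) = w 0 := by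
    linear_combination (w 0) * Real.cos_sq_add_sin_sq θ
  have h1 : Real.cos θ * (Real.cos θ * w 1 + Real.sin θ * w 0) +
      -Real.sin θ * (Real.cos θ * w 0 - Real.sin θ * w 1) = w 1 := by
    linear_combination (w 1) * Real.cos_sq_add_sin_sq θ
  rw [Real.cos_neg, Real.sin_neg]
  ext i
  fin_cases i
  · simp
    linear_combination h0
  · simp
    linear_combination h1

/-- **Fibre rotation of the tube by a variable angle.** Let `a : ℝ² × ℝ → ℝ` be smooth with
`a (u, s) = 0` whenever `ρ² ≤ s`. Then there is a compactly supported isotopy `Θ` of `S¹ × ℝ²`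
with supporting radius `ρ` and stages
`Θ t (x, w) = (x, cos (t a(x, ‖w‖²)) • w + sin (t a(x, ‖w‖²)) • J w)`: each stage rotates the
fibre circle through `w` over `x` by the angle `t a(x, ‖w‖²)` (so it preserves `‖w‖`, hence the
angle function, and its inverse is the rotation by the opposite angle). Hirsch (1976), Ch. 8 §1.
[cite: HirschDT1976, Ch. 8 §1] -/
theorem exists_tubeIsotopy_fibreRotation {a : EuclideanSpace ℝ (Fin 2) × ℝ → ℝ} (ha : ContDiff ℝ ∞ a)
    {ρ : ℝ} (hρ : 0 ≤ ρ) (ha0 : ∀ u s, ρ ^ 2 ≤ s → a (u, s) = 0) :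
    ∃ Θ : TubeIsotopy, Θ.radius = ρ ∧
      ∀ (t : ℝ) (x : Metric.sphere (0 : EuclideanSpace ℝ (Fin 2)) 1) (w : EuclideanSpace ℝ (Fin 2)),
        Θ.toFun t (x, w) = (x, Real.cos (t * a ((x : EuclideanSpace ℝ (Fin 2)), ‖w‖ ^ 2)) • w +
          Real.sin (t * a ((x : EuclideanSpace ℝ (Fin 2)), ‖w‖ ^ 2)) •
            ((-(w 1)) • EuclideanSpace.single (0 : Fin 2) (1 : ℝ) + (w 0) • EuclideanSpace.single 1 1)) := by
  haveI := fact_finrank_euclideanSpace_succ 1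
  -- the rotation as an opaque local function of `(θ, w)` with its defining equation
  obtain ⟨rot, hrot⟩ : ∃ rot : ℝ → EuclideanSpace ℝ (Fin 2) → EuclideanSpace ℝ (Fin 2),
      rot = fun θ w ↦ Real.cos θ • w + Real.sin θ •
        ((-(w 1)) • EuclideanSpace.single (0 : Fin 2) (1 : ℝ) + (w 0) • EuclideanSpace.single 1 1) :=
    ⟨_, rfl⟩
  have hrot_apply : ∀ θ w, rot θ w = Real.cos θ • w + Real.sin θ •
      ((-(w 1)) • EuclideanSpace.single (0 : Fin 2) (1 : ℝ) + (w 0) • EuclideanSpace.single 1 1) :=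
    fun θ w ↦ by rw [hrot]
  have hrots : ContDiff ℝ ∞ fun p : ℝ × EuclideanSpace ℝ (Fin 2) ↦ rot p.1 p.2 := by
    rw [hrot]; exact contDiff_rotate
  have hnorm : ∀ θ w, ‖rot θ w‖ = ‖w‖ := fun θ w ↦ by rw [hrot_apply]; exact norm_rotate θ w
  have hrot_eq : ∀ θ w, rot θ w = (Real.cos θ * w 0 - Real.sin θ * w 1) •
      EuclideanSpace.single (0 : Fin 2) (1 : ℝ) + (Real.cos θ * w 1 + Real.sin θ * w 0) •
        EuclideanSpace.single 1 1 := fun θ w ↦ by rw [hrot_apply]; exact rotate_eq θ w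
  have hinv : ∀ θ w, rot (-θ) (rot θ w) = w := fun θ w ↦ by
    have hc0 : (rot θ w) 0 = Real.cos θ * w 0 - Real.sin θ * w 1 := by rw [hrot_eq]; simp
    have hc1 : (rot θ w) 1 = Real.cos θ * w 1 + Real.sin θ * w 0 := by rw [hrot_eq]; simp
    rw [hrot_apply (-θ), hc0, hc1, hrot_eq]
    exact rotate_neg_rotate θ w
  have hinv' : ∀ θ w, rot θ (rot (-θ) w) = w := fun θ w ↦ by
    have := hinv (-θ) w; rwa [neg_neg] at this
  have hrot0 : ∀ w, rot 0 w = w := fun w ↦ by rw [hrot_apply]; simp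
  -- the angle as a function of `(t, u, w)` on the ambient space
  have hangs : ContDiff ℝ ∞ fun q : ℝ × (EuclideanSpace ℝ (Fin 2) × EuclideanSpace ℝ (Fin 2)) ↦
      q.1 * a (q.2.1, ‖q.2.2‖ ^ 2) :=
    contDiff_fst.mul (ha.comp ((contDiff_fst.comp contDiff_snd).prodMk
      ((contDiff_norm_sq ℝ).comp (contDiff_snd.comp contDiff_snd))))
  -- the forward and backward families
  set F : ℝ → (Metric.sphere (0 : EuclideanSpace ℝ (Fin 2)) 1) × EuclideanSpace ℝ (Fin 2) →
      (Metric.sphere (0 : EuclideanSpace ℝ (Fin 2)) 1) × EuclideanSpace ℝ (Fin 2) :=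
    fun t q ↦ (q.1, rot (t * a ((q.1 : EuclideanSpace ℝ (Fin 2)), ‖q.2‖ ^ 2)) q.2) with hF
  set G : ℝ → (Metric.sphere (0 : EuclideanSpace ℝ (Fin 2)) 1) × EuclideanSpace ℝ (Fin 2) →
      (Metric.sphere (0 : EuclideanSpace ℝ (Fin 2)) 1) × EuclideanSpace ℝ (Fin 2) :=
    fun t q ↦ (q.1, rot (-(t * a ((q.1 : EuclideanSpace ℝ (Fin 2)), ‖q.2‖ ^ 2))) q.2) with hG
  -- smoothness: through the ambient `ℝ × (ℝ² × ℝ²)`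
  have hamb : ContMDiff (𝓘(ℝ, ℝ).prod ((𝓡 1).prod 𝓘(ℝ, EuclideanSpace ℝ (Fin 2))))
      𝓘(ℝ, ℝ × (EuclideanSpace ℝ (Fin 2) × EuclideanSpace ℝ (Fin 2))) ∞
      fun q : ℝ × ((Metric.sphere (0 : EuclideanSpace ℝ (Fin 2)) 1) × EuclideanSpace ℝ (Fin 2)) ↦
        (q.1, ((q.2.1 : EuclideanSpace ℝ (Fin 2)), q.2.2)) :=
    contMDiff_fst.prodMk_space
      ((contMDiff_coe_sphere.comp (contMDiff_fst.comp contMDiff_snd)).prodMk_space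
        (contMDiff_snd.comp contMDiff_snd))
  have hF2 : ContDiff ℝ ∞ fun q : ℝ × (EuclideanSpace ℝ (Fin 2) × EuclideanSpace ℝ (Fin 2)) ↦
      rot (q.1 * a (q.2.1, ‖q.2.2‖ ^ 2)) q.2.2 := hrots.comp (hangs.prodMk (contDiff_snd.comp contDiff_snd))
  have hG2 : ContDiff ℝ ∞ fun q : ℝ × (EuclideanSpace ℝ (Fin 2) × EuclideanSpace ℝ (Fin 2)) ↦
      rot (-(q.1 * a (q.2.1, ‖q.2.2‖ ^ 2))) q.2.2 :=
    hrots.comp (hangs.neg.prodMk (contDiff_snd.comp contDiff_snd))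
  have hFs : ContMDiff (𝓘(ℝ, ℝ).prod ((𝓡 1).prod 𝓘(ℝ, EuclideanSpace ℝ (Fin 2))))
      ((𝓡 1).prod 𝓘(ℝ, EuclideanSpace ℝ (Fin 2))) ∞ (uncurry F) :=
    (contMDiff_fst.comp contMDiff_snd).prodMk (hF2.comp_contMDiff hamb)
  have hGs : ContMDiff (𝓘(ℝ, ℝ).prod ((𝓡 1).prod 𝓘(ℝ, EuclideanSpace ℝ (Fin 2))))
      ((𝓡 1).prod 𝓘(ℝ, EuclideanSpace ℝ (Fin 2))) ∞ (uncurry G) :=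
    (contMDiff_fst.comp contMDiff_snd).prodMk (hG2.comp_contMDiff hamb)
  -- the two families are inverse to each other
  have hGF : ∀ t q, G t (F t q) = q := fun t q ↦ by
    obtain ⟨x, w⟩ := q
    simp only [F, G, hnorm]
    exact Prod.ext rfl (hinv _ w)
  have hFG : ∀ t q, F t (G t q) = q := fun t q ↦ by
    obtain ⟨x, w⟩ := q
    simp only [F, G, hnorm]
    exact Prod.ext rfl (hinv' _ w)
  have h0 : F 0 = id := by
    funext q
    obtain ⟨x, w⟩ := q
    simp only [F, zero_mul, hrot0, id]
  set D := Diffeotopy.mk' ((𝓡 1).prod 𝓘(ℝ, EuclideanSpace ℝ (Fin 2))) F G hFs hGs hGF hFG h0 with hD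
  refine ⟨{ toAmbientIsotopy := D.toAmbientIsotopy, radius := ρ, eq_self := ?_ }, rfl, ?_⟩
  · intro t q hq
    obtain ⟨x, w⟩ := q
    change F t (x, w) = (x, w)
    have hq' : ρ ^ 2 ≤ ‖w‖ ^ 2 := pow_le_pow_left₀ hρ hq 2
    have ha' : a ((x : EuclideanSpace ℝ (Fin 2)), ‖w‖ ^ 2) = 0 := ha0 _ _ hq'
    simp only [F, ha', mul_zero, hrot0]
  · intro t x w
    change F t (x, w) = _
    simp only [F, hrot_apply]

end SlideSweep

end Literature.Topology.FourManifolds
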